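import Summits.BirchSwinnertonDyer.BirchSwinnertonDyer.Theorems.ByReductionTypeAtTwoAdditivePotGoodPrintFamily56b1Descent
import Summits.BirchSwinnertonDyer.BirchSwinnertonDyer.Theorems.ByReductionTypeAtTwoAdditivePotGoodPrintFamily56b1ShaTrivial
import Summits.BirchSwinnertonDyer.Rank1Residual.Supersingular.RationalLadder
import Literature.NumberTheory.QuadraticFields.FundamentalDiscriminant
import Literature.NumberTheory.QuadraticFields.ClassNumberOne
import Literature.NumberTheory.QuadraticFields.KroneckerSplitting
import Literature.NumberTheory.EllipticCurves.HeegnerPoints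
import HarnessLib

/-!
# K4 crux `AdditiveRankZeroAtTwo` (19098), children C3″ (22617) / C2″ (22616): the `56b1` Thm-1.5 road is NOT VACUOUS —
# the member `M = 65 = 5·13` with every twisting hypothesis DISCHARGED IN THE KERNEL

Cell `bsd-2adic`, seat `bsd-2adic-k4-w2` GEN 5 (prover, explicit unit, no kit); `--supports stmt-BirchSwinnertonDyer-22617
--as helper`. HONEST FRAMING (D-0036/D-0054): `printFamily56b1_of_thm15_certified` (`…PrintFamily56b1Descent.lean`) decides
C3″/C2″ (indeed BSD₂ with `Ш(W)(2) = 0`) at every global minimal `W ≅ 56b1^{(∏Q)}` for `Q ⊆ 𝒮(56b1)` nonempty with every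
`ℓ ∣ 2N` split in `ℚ(√∏Q)`, from CLZ Thm. 1.1 + 1.5 (PROVED) + ARS Thm. 2.6 and three displayed base records. THIS FILE checks,
in the kernel, that the twisting hypotheses are met by `Q = {5, 13}`, `M = 65`: `5, 13 ∈ 𝒮(56b1)` (`q ≡ 1 (mod 4)`, `q ∤ N`
since `N ∣ Δ_min = 2¹⁰·7`, `#Ẽ(𝔽₅) = 10`, `#Ẽ(𝔽₁₃) = 14` have `ord₂ = 1` — point counts by the tree's certified
`countPoints`), and the Heegner-type condition for `2N`: in EVERY quadratic field `K ∋ √65` one has `d_K = 65`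
(`discr_eq_of_sq_eq_of_fundamental`, a real-quadratic companion of the tree's `KrizLi2019.discr_eq_of_sq_eq`), so `2` splits
(`65 ≡ 1 (mod 8)`) and `7` splits (`(65/7) = (2/7) = 1`) — tree `Quadratic.ncard_primesOver_two_eq_two_iff`,
`Quadratic.ncard_primesOver_eq_two_iff_legendreSym`. Net: `printFamily56b1_witness65` — BSD₂ (both K4 halves, `Ш(W)(2) = 0`,
`r_an = 0`, additive potentially good at `2`, non-CM, `W[2]` reducible) at every global minimal model of `56b1^{(65)}`
(conductor `2³·7·5²·13²`-class curve), displaying ONLY the three base records (optimal datum, `ord₂ L^alg(56b1) = −1`,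
`BSD(56b1, 2)`) and the five named inputs. Closes nothing at the `∀`-level; BSD is not proved by any of this.

References: [CaiLiZhai2019] Thm. 1.1, 1.5, §6.2.2; [Marcus1977] Ch. 2 Thm. 1; [GrossLMS1991] §1; [SilvermanAEC2009] V.2, VIII.11.
-/

set_option autoImplicit false
set_option linter.dupNamespace false

noncomputable section

open scoped Classical

open Module NumberField WeierstrassCurve Literature.NumberTheory.EllipticCurves
  Literature.NumberTheory.EllipticCurves.Rank1Residual
  Literature.NumberTheory.EllipticCurves.Rank1Residual.Typed
  Literature.NumberTheory.EllipticCurves.CaiLiZhai2019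
  Literature.NumberTheory.EllipticCurves.ModularForms
  Literature.NumberTheory.EllipticCurves.AgasheRibetStein2006
  Literature.NumberTheory.EllipticCurves.Rank1Residual.X11RankOneCertificates
  Literature.NumberTheory.QuadraticFields.Quadratic
  Summit.BirchSwinnertonDyer.Rank1Residual
  Summit.BirchSwinnertonDyer.Rank1Residual.X5.O1
  Summit.BirchSwinnertonDyer.Rank1Residual.P2
  Summit.BirchSwinnertonDyer.Rank1Residual.Supersingular
  Summit.BirchSwinnertonDyer.BirchSwinnertonDyer.Rank1Residual.IntModel

namespace Summit.BirchSwinnertonDyer.BirchSwinnertonDyer.Theorems.AddPotGoodPrint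

/-! ## §1 Quadratic fields containing `√65`: `d_K = 65`, `2` and `7` split -/

/-- **`d_F = d` for a quadratic field `F ∋ √d` with `d ≡ 1 (mod 4)` squarefree, `d ≠ 1`, `d` not a rational square** (real
or imaginary; the tree's `KrizLi2019.discr_eq_of_sq_eq` is the imaginary case): `disc(1, √d) = 4d = r²·d_F` and two fundamental
discriminants differing by a rational square coincide. [cite: Marcus1977, Ch. 2 Thm. 1] -/
theorem discr_eq_of_sq_eq_of_fundamental {F : Type*} [Field F] [NumberField F] (h2 : finrank ℚ F = 2)
    {d : ℤ} (hfund : d % 4 = 1 ∧ Squarefree d ∧ d ≠ 1) (hnsq : ∀ q : ℚ, q ^ 2 ≠ d)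
    {x : F} (hx : x ^ 2 = (d : F)) : NumberField.discr F = d := by
  have hint : IsIntegral ℤ x := isIntegral_of_sq_eq_intCast hx
  have hθ : x ∉ Set.range (algebraMap ℚ F) := by
    rintro ⟨q, hq⟩
    have h' : algebraMap ℚ F (q ^ 2) = algebraMap ℚ F (d : ℚ) := by
      rw [map_pow, hq, hx, map_intCast]
    exact hnsq q ((algebraMap ℚ F).injective h')
  obtain ⟨r, hr0, hr⟩ := exists_discr_basisOneSqrt_eq_sq_mul_discr h2 hθ hint
  have hrel : x ^ 2 + algebraMap ℚ F 0 * x + algebraMap ℚ F (-(d : ℚ)) = 0 := by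
    rw [hx, map_zero, zero_mul, add_zero, map_neg, map_intCast, add_neg_cancel]
  rw [discr_basisOneSqrt_of_quadratic h2 hθ hrel] at hr
  have hr0' : (r : ℚ) ≠ 0 := by exact_mod_cast hr0
  refine eq_of_isFundamental_of_eq_mul_sq (isFundamentalDiscriminant_discr h2) (Or.inl hfund)
    (q := 2 / r) ?_
  field_simp
  linear_combination (-1 : ℚ) * hr

/-- `65` is not a rational square. [folklore] -/
theorem not_sq_eq_65 (q : ℚ) : q ^ 2 ≠ (65 : ℤ) := by
  intro h
  have h2 : ∃ r : ℚ, r * r = 65 := ⟨q, by push_cast at h; rw [← sq]; exact h⟩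
  rw [Rat.exists_mul_self] at h2
  exact absurd h2 (by norm_num [Rat.sqrt, Nat.sqrt])

/-- `65 = 5·13` is squarefree. [folklore] -/
theorem squarefree_65 : Squarefree (65 : ℤ) := by
  rw [show (65 : ℤ) = (65 : ℕ) by rfl, Int.squarefree_natCast]; exact (by decide +kernel : Squarefree (65 : ℕ))

/-- **In every quadratic field containing `√65`, the primes `2` and `7` split** (`d_K = 65 ≡ 1 (mod 8)`; `(65/7) = 1`
since `65 ≡ 2 ≡ 3² (mod 7)`). [cite: GrossLMS1991, §1 (p. 235)] [cite: Marcus1977, Ch. 3 Thm. 25] -/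
theorem split_two_seven_of_sqrt65 (K : Type) [Field K] [NumberField K] (h2 : finrank ℚ K = 2)
    (hx : ∃ x : K, x ^ 2 = ((65 : ℕ) : K)) :
    ((Ideal.span {(2 : ℤ)}).primesOver (𝓞 K)).ncard = 2 ∧ ((Ideal.span {(7 : ℤ)}).primesOver (𝓞 K)).ncard = 2 := by
  obtain ⟨x, hx⟩ := hx
  have hd : NumberField.discr K = 65 :=
    discr_eq_of_sq_eq_of_fundamental h2 ⟨by norm_num, squarefree_65, by norm_num⟩ not_sq_eq_65
      (by rw [hx]; push_cast; rfl)
  refine ⟨(ncard_primesOver_two_eq_two_iff h2).mpr (by rw [hd]; norm_num), ?_⟩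
  have h65 : ((65 : ℤ) : ZMod 7) ≠ 0 := by decide
  have hsq : IsSquare ((65 : ℤ) : ZMod 7) := ⟨3, by decide⟩
  haveI : Fact (Nat.Prime 7) := ⟨by norm_num⟩
  refine (ncard_primesOver_eq_two_iff_legendreSym h2 (by norm_num)).mpr ?_
  rw [hd]
  exact (legendreSym.eq_one_iff 7 h65).mpr hsq

/-! ## §2 `56b1`: `N ∣ 2¹⁰·7`, and `5, 13 ∈ 𝒮(56b1)` -/

/-- The integral model of the global minimal `56b1` is `[0,−1,0,0,−4]` itself. [cite: CaiLiZhai2019, §6.2.2] -/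
theorem integralModelInt_C56B1 [C56B1.IsGloballyMinimal] :
    integralModelInt C56B1 = (⟨0, -1, 0, 0, -4⟩ : WeierstrassCurve ℤ) :=
  integralModelInt_eq_of_map_eq _ C56B1Int_map

/-- **`N(56b1) ∣ 7168 = 2¹⁰·7 = |Δ_min|`** (the conductor divides the minimal discriminant; Cremona: `N = 56`, not needed).
[cite: SilvermanAEC2009, VIII.11 (f_p ≤ ord_p Δ_min)] -/
theorem conductorNorm_C56B1_dvd [C56B1.IsElliptic] [C56B1.IsGloballyMinimal] : C56B1.conductorNorm ℤ ∣ 7168 := by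
  have hdvd := WeierstrassCurve.conductorNorm_dvd_minimalDiscriminantNorm C56B1
    (WeierstrassCurve.finite_setOf_ordMinimalDiscriminant_ne_zero_holds C56B1)
  rw [WeierstrassCurve.minimalDiscriminantNorm_int_eq_natAbs_minimalDiscriminantInt_holds C56B1,
    minimalDiscriminantInt_eq integralModelInt_C56B1] at hdvd
  have hΔ : ((⟨0, -1, 0, 0, -4⟩ : WeierstrassCurve ℤ).Δ).natAbs = 7168 := by
    simp only [WeierstrassCurve.Δ, WeierstrassCurve.b₂, WeierstrassCurve.b₄, WeierstrassCurve.b₆, WeierstrassCurve.b₈]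
    norm_num
  rwa [hΔ] at hdvd

/-- Every prime dividing `2·N(56b1)` is `2` or `7`. [cite: SilvermanAEC2009, VIII.11] -/
theorem eq_two_or_seven_of_dvd_two_mul_conductorNorm_C56B1 [C56B1.IsElliptic] [C56B1.IsGloballyMinimal] {p : ℕ}
    (hp : p.Prime) (h : p ∣ 2 * C56B1.conductorNorm ℤ) : p = 2 ∨ p = 7 := by
  have h' : p ∣ 2 * 7168 := dvd_trans h (mul_dvd_mul_left 2 conductorNorm_C56B1_dvd)
  rcases (Nat.Prime.dvd_mul hp).mp h' with h2 | h7
  · exact Or.inl ((Nat.prime_dvd_prime_iff_eq hp Nat.prime_two).mp h2)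
  · rw [show (7168 : ℕ) = 2 ^ 10 * 7 by norm_num] at h7
    rcases (Nat.Prime.dvd_mul hp).mp h7 with h2 | h7
    · exact Or.inl ((Nat.prime_dvd_prime_iff_eq hp Nat.prime_two).mp (hp.dvd_of_dvd_pow h2))
    · exact Or.inr ((Nat.prime_dvd_prime_iff_eq hp (by norm_num)).mp h7)

/-- `ord₂ 10 = 1`. [folklore] -/
private theorem padicValNat_two_10 : padicValNat 2 10 = 1 := by
  haveI : Fact (Nat.Prime 2) := ⟨Nat.prime_two⟩
  rw [show (10 : ℕ) = 2 * 5 from rfl, padicValNat.mul (by norm_num) (by norm_num), padicValNat_self,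
    padicValNat.eq_zero_of_not_dvd (by norm_num)]

/-- `ord₂ 14 = 1`. [folklore] -/
private theorem padicValNat_two_14 : padicValNat 2 14 = 1 := by
  haveI : Fact (Nat.Prime 2) := ⟨Nat.prime_two⟩
  rw [show (14 : ℕ) = 2 * 7 from rfl, padicValNat.mul (by norm_num) (by norm_num), padicValNat_self,
    padicValNat.eq_zero_of_not_dvd (by norm_num)]

/-- **`5 ∈ 𝒮(56b1)`**: `5 ≡ 1 (mod 4)`, `5 ∤ N`, `#Ẽ(𝔽₅) = 10` so `ord₂ N₅ = 1` (point count by the tree's certified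
`countPoints`, `decide +kernel`). [cite: CaiLiZhai2019, §6.2.2 (5 ∈ 𝒮)] [cite: SilvermanAEC2009, V.2] -/
theorem inS_C56B1_five [C56B1.IsElliptic] [C56B1.IsGloballyMinimal] : InS C56B1 5 := by
  refine ⟨by norm_num, by norm_num, fun h => ?_, ?_⟩
  · have := Nat.dvd_trans h conductorNorm_C56B1_dvd
    norm_num at this
  · haveI : Fact (Nat.Prime 5) := ⟨by norm_num⟩
    have hN : C56B1.reductionPointCount 5 = 10 :=
      reductionPointCount_eq_of_intModel_countPoints integralModelInt_C56B1 5 (by norm_num) (by decide +kernel)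
        (by decide +kernel)
    rw [hN, padicValNat_two_10]

/-- **`13 ∈ 𝒮(56b1)`**: `13 ≡ 1 (mod 4)`, `13 ∤ N`, `#Ẽ(𝔽₁₃) = 14` so `ord₂ N₁₃ = 1`.
[cite: CaiLiZhai2019, §6.2.2 (13 ∈ 𝒮)] [cite: SilvermanAEC2009, V.2] -/
theorem inS_C56B1_thirteen [C56B1.IsElliptic] [C56B1.IsGloballyMinimal] : InS C56B1 13 := by
  refine ⟨by norm_num, by norm_num, fun h => ?_, ?_⟩
  · have := Nat.dvd_trans h conductorNorm_C56B1_dvd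
    norm_num at this
  · haveI : Fact (Nat.Prime 13) := ⟨by norm_num⟩
    have hN : C56B1.reductionPointCount 13 = 14 :=
      reductionPointCount_eq_of_intModel_countPoints integralModelInt_C56B1 13 (by norm_num) (by decide +kernel)
        (by decide +kernel)
    rw [hN, padicValNat_two_14]

/-! ## §3 The member `M = 65` -/

/-- `∏ {5, 13} = 65`. [folklore] -/
private theorem prod_five_thirteen : (∏ q ∈ ({5, 13} : Finset ℕ), q) = 65 := by decide

/-- **BSD₂ (both K4 halves, `Ш(W)(2) = 0`) at every global minimal model of `56b1^{(65)}`** — the `2N`-split member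
`Q = {5, 13}` of the CLZ Thm-1.5 family, with `5, 13 ∈ 𝒮(56b1)` and «`2`, `7` split in `ℚ(√65)`» IN THE KERNEL, on top of
`printFamily56b1_of_thm15_certified` (kernel: `#E(ℚ)[2] = 2`, the `2`-isogeny, `#ker = 2`, `Ш(E′)[2] = 0`, habitat).
Displayed: the optimal datum (`Dt`, `hopt`), `ord₂(L(56b1,1)/Ω) = −1` (`hL`), `BSD(56b1, 2)` (`hbase`); named inputs CLZ
Thm. 1.1/1.5, ARS Thm. 2.6, modularity, GZK. BSD is not proved by any of this.
[cite: CaiLiZhai2019, Thm. 1.1, Thm. 1.5 and §6.2.2] [cite: AgasheRibetStein2006, Thm. 2.6] -/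
theorem printFamily56b1_witness65 (h11 : thm11_ord_two_LAlg_twist) (h15 : thm15_twoPartBSD_twist)
    (h26 : cremona_abs_maninConstant_eq_one_of_level_le) (hmod : hasEntireLFunction_rat)
    (hGZK : rank_eq_analyticRank_of_analyticRank_le_one)
    [C56B1.IsElliptic] [C56B1.IsGloballyMinimal] [NeZero (C56B1.conductorNorm ℤ)]
    (Dt : ModularParametrizationData C56B1 (C56B1.conductorNorm ℤ))
    (hopt : ∀ z ∈ Dt.L.lattice, ∃ w ∈ periodLattice Dt.f, z = Dt.c * w)
    (hL : ∃ q : ℚ, C56B1.entireLFunction 1 = (q : ℂ) * (C56B1.realPeriodRat : ℂ) ∧ padicValRat 2 q = -1)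
    (hbase : BSDp C56B1 2)
    (W : WeierstrassCurve ℚ) [W.IsElliptic] [W.IsGloballyMinimal]
    (hW : ∃ C : VariableChange ℚ, C • C56B1.quadraticTwist 65 = W) :
    W.analyticRank = 0 ∧ Addv W 2 ∧ 0 ≤ padicValRat 2 W.j ∧ ¬ W.HasCM ∧ Red W 2 ∧
      AddCommGroup.primaryComponent W.sha 2 = ⊥ ∧ BSDp W 2 ∧ MissingLowerBoundAt W 2 ∧ MissingUpperBoundAt W 2 := by
  have hQ : ({5, 13} : Finset ℕ).Nonempty := ⟨5, by simp⟩
  have hS : ∀ q ∈ ({5, 13} : Finset ℕ), InS C56B1 q := by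
    intro q hq
    simp only [Finset.mem_insert, Finset.mem_singleton] at hq
    rcases hq with rfl | rfl
    · exact inS_C56B1_five
    · exact inS_C56B1_thirteen
  have hsplit : ∀ (K : Type) [Field K] [NumberField K], Module.finrank ℚ K = 2 →
      (∃ x : K, x ^ 2 = ((∏ q ∈ ({5, 13} : Finset ℕ), q : ℕ) : K)) →
      SatisfiesHeegnerHypothesis (2 * C56B1.conductorNorm ℤ) K := by
    intro K _ _ h2 hx
    rw [prod_five_thirteen] at hx
    obtain ⟨h2s, h7s⟩ := split_two_seven_of_sqrt65 K h2 hx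
    intro p hp hpN
    rcases eq_two_or_seven_of_dvd_two_mul_conductorNorm_C56B1 hp hpN with rfl | rfl
    · simpa using h2s
    · simpa using h7s
  have hW' : ∃ C : VariableChange ℚ, C • C56B1.quadraticTwist ((∏ q ∈ ({5, 13} : Finset ℕ), q : ℕ) : ℚ) = W := by
    rw [prod_five_thirteen]; exact_mod_cast hW
  exact printFamily56b1_of_thm15_certified h11 h15 h26 hmod hGZK Dt hopt hL hbase {5, 13} hQ hS hsplit W hW'

/-! ## Appended: the member `M = 65` with `BSD(56b1, 2)` replaced by the record `ord₂ #Ш_an(56b1) = 0` -/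

/-- **BSD₂ (both K4 halves, `Ш(W)(2) = 0`) at every global minimal model of `56b1^{(65)}`**, displaying ONLY the optimal datum
(`Dt`, `hopt`) and the two numeric records `ord₂(L(56b1,1)/Ω) = −1` (`hL`), `ord₂ #Ш_an(56b1) = 0` (`hShaAn`) — Miller's
`BSD(56b1, 2)` itself coming from `bsdp_two_C56B1_of_shaAn` (kernel: `rank 56b1 = 0`, `Ш(56b1)[2^∞] = 0`; modularity for
`r_an = 0`). Inputs BY NAME: CLZ Thm. 1.1/1.5, ARS Thm. 2.6, modularity, GZK. BSD is not proved by any of this.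
[cite: CaiLiZhai2019, Thm. 1.1, Thm. 1.5 and §6.2.2] [cite: AgasheRibetStein2006, Thm. 2.6] [cite: Miller2011LMS, Def. 1.1] -/
theorem printFamily56b1_witness65' (h11 : thm11_ord_two_LAlg_twist) (h15 : thm15_twoPartBSD_twist)
    (h26 : cremona_abs_maninConstant_eq_one_of_level_le) (hmod : hasEntireLFunction_rat)
    (hGZK : rank_eq_analyticRank_of_analyticRank_le_one)
    [C56B1.IsElliptic] [C56B1.IsGloballyMinimal] [NeZero (C56B1.conductorNorm ℤ)]
    (Dt : ModularParametrizationData C56B1 (C56B1.conductorNorm ℤ))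
    (hopt : ∀ z ∈ Dt.L.lattice, ∃ w ∈ periodLattice Dt.f, z = Dt.c * w)
    (hL : ∃ q : ℚ, C56B1.entireLFunction 1 = (q : ℂ) * (C56B1.realPeriodRat : ℂ) ∧ padicValRat 2 q = -1)
    (hShaAn : ∃ q : ℚ, shaAn C56B1 = (q : ℂ) ∧ padicValRat 2 q = 0)
    (W : WeierstrassCurve ℚ) [W.IsElliptic] [W.IsGloballyMinimal]
    (hW : ∃ C : VariableChange ℚ, C • C56B1.quadraticTwist 65 = W) :
    W.analyticRank = 0 ∧ Addv W 2 ∧ 0 ≤ padicValRat 2 W.j ∧ ¬ W.HasCM ∧ Red W 2 ∧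
      AddCommGroup.primaryComponent W.sha 2 = ⊥ ∧ BSDp W 2 ∧ MissingLowerBoundAt W 2 ∧ MissingUpperBoundAt W 2 :=
  printFamily56b1_witness65 h11 h15 h26 hmod hGZK Dt hopt hL (bsdp_two_C56B1_of_shaAn hmod hL hShaAn) W hW

end Summit.BirchSwinnertonDyer.BirchSwinnertonDyer.Theorems.AddPotGoodPrint

end
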